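import Summits.CriticalPhenomena.SAWScalingLimit.Theorems.SAWDefectDecoherencePolygonParitySqueezeDefs
import Summits.CriticalPhenomena.SAWScalingLimit.Theorems.SAWDefectDecoherenceBoundaryClosureRSqueezeGateStability
import Summits.CriticalPhenomena.SAWScalingLimit.Theorems.SAWDefectDecoherenceBoundaryClosureRGateProfileAnalysis
import Summits.CriticalPhenomena.SAWScalingLimit.Theorems.SAWDefectDecoherenceBoundaryClosureRGateProfileSideSums
import HarnessLib

/-!
# Crux `BoundaryClosureR` (stmt-CriticalPhenomena-14004), line `polygon-parity-squeeze`,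
# stub `gateProfile_of_identification` (piece F of the (A) assembly): ratio mixing fixes the constant

THEOREM (`const_eq_one_of_ratioMixing`).  Let `(Λ, a, b)` be an admissible family on `D` (pinned
ball `B(pt 1, ρ)`) satisfying `RatioMixingAt Λ a b`, let `μ` be the weak-* limit of the normalised
boundary arrival sums `S_δ(w) = δ Σ_{e ∈ ∂Λ_δ} w(δ·mid e) ‖F₀ e‖/‖F₀ b_δ‖` along a mesh sequence
`ns' → 0⁺` for real test functions supported in `B(pt 1, ρ/2)`, and suppose that on these test
functions `μ` is `K` times a continuous line density `E` on the gate with `E(re pt 1) = 1`: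
`∫ w dμ = K ∫ w(x + i im pt 1) E(x) dx`.  Then `K = 1`.
Proof: for `γ > 0`, flat-top bumps `w₊ = 1` on `B(pt 1, s(1+ε))`, supported in `B̄(pt 1, s(1+2ε))`,
and `w₋ = 1` on `B̄(pt 1, s(1−2ε))`, supported in `B̄(pt 1, s(1−ε))` (`ε = γ/4`, `s` small) sandwich
the ratio-mixing window (`GateProfile.eventually_le_sideSum_of_ratioMixing`,
`eventually_sideSum_le_of_ratioMixing`): `2s(1−ε) ≤ ∫ w₊ dμ`, `∫ w₋ dμ ≤ 2s(1+ε)`; their line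
masses `V±` lie between `2 rIn` and `2 rOut` and their `E`-weighted line integrals are within `γ V±`
of `V±` (continuity of `E` at `re pt 1`); `GateProfile.eq_one_of_sandwich` concludes.

References: G. Lawler, O. Schramm, W. Werner (2004), §3.4; H. Duminil-Copin, S. Smirnov (2012), §3.
-/

noncomputable section

open scoped BigOperators Topology
open Filter Set Metric MeasureTheory Complex
open Literature.Probability.LatticeModels Literature.Probability.RandomPlanarGeometry
open Literature.Probability.RandomPlanarGeometry.SAW

namespace Summit.CriticalPhenomena.SAWScalingLimit.Theorems.PolygonParitySqueeze.GateProfile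

/-- **Sandwich data at scale `γ`.** Under the hypotheses of `const_eq_one_of_ratioMixing`, for every
`γ ∈ (0, 1/2]` there are reals `J₊, V₊, J₋, V₋` and complex `P₊, P₋` with `V± > 0`,
`(1 − γ) V₊ ≤ J₊`, `J₋ ≤ (1 + γ) V₋`, `‖P± − V±‖ ≤ γ V±` and `J± = K P±` (the `μ`-masses, line
masses and `E`-weighted line integrals of two flat-top bumps around `pt 1`).
[cite: LawlerSchrammWerner2004SAW, §3.4 (restriction / boundary scaling heuristics)] -/
theorem exists_sandwich_data {D : DobrushinDomain} {ρ : ℝ} {Λ : ℝ → Finset HexVertex}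
    {m : ℝ → ℤ} {b : ℝ → Sym2 HexVertex} (hAF : AdmissibleFamily D ρ Λ m b) {a : ℝ → Sym2 HexVertex}
    (hRM : RatioMixingAt Λ a b) {ns' : ℕ → ℝ} (hns' : Tendsto ns' atTop (𝓝[>] 0)) {μ : Measure ℂ}
    (hside : ∀ w : ℂ → ℝ, Continuous w → HasCompactSupport w → tsupport w ⊆ ball (D.pt 1) (ρ / 2) →
      Tendsto (fun n => ns' n * ∑ᶠ e ∈ hexDomainBoundary (Λ (ns' n)),
        w ((ns' n : ℂ) * hexMidpoint e) *
          (‖hexParafermionicObservable (Λ (ns' n)) (a (ns' n)) hexCriticalFugacity 0 e‖ /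
            ‖hexParafermionicObservable (Λ (ns' n)) (a (ns' n)) hexCriticalFugacity 0 (b (ns' n))‖))
        atTop (𝓝 (∫ z, w z ∂μ)))
    {E : ℝ → ℂ} (hE : ContinuousOn E (Icc ((D.pt 1).re - ρ / 2) ((D.pt 1).re + ρ / 2)))
    (hE1 : E (D.pt 1).re = 1) {K : ℂ}
    (hK : ∀ w : ℂ → ℝ, Continuous w → HasCompactSupport w → tsupport w ⊆ ball (D.pt 1) (ρ / 2) →
      ((∫ z, w z ∂μ : ℝ) : ℂ) = K * ∫ x in Set.Ioo ((D.pt 1).re - ρ / 2) ((D.pt 1).re + ρ / 2),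
        (w ((x : ℂ) + ((D.pt 1).im : ℂ) * I) : ℂ) * E x)
    {γ : ℝ} (hγ : 0 < γ) (hγ2 : γ ≤ 1 / 2) :
    ∃ (Jp Vp : ℝ) (Pp : ℂ) (Jm Vm : ℝ) (Pm : ℂ), 0 < Vp ∧ (1 - γ) * Vp ≤ Jp ∧ ‖Pp - Vp‖ ≤ γ * Vp ∧
      (Jp : ℂ) = K * Pp ∧ 0 < Vm ∧ Jm ≤ (1 + γ) * Vm ∧ ‖Pm - Vm‖ ≤ γ * Vm ∧ (Jm : ℂ) = K * Pm := by
  have hρ : 0 < ρ := hAF.1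
  set p : ℂ := D.pt 1 with hp
  set ε : ℝ := γ / 4 with hεdef
  have hε : 0 < ε := by positivity
  ---------------------------------------------------------------- continuity of `E` at `re p`
  have hEat : ContinuousAt E p.re :=
    hE.continuousAt (Icc_mem_nhds (by linarith) (by linarith))
  obtain ⟨r₁, hr₁, hEr⟩ := Metric.continuousAt_iff.1 hEat γ hγ
  have hEγ : ∀ x, |x - p.re| < r₁ → ‖E x - 1‖ ≤ γ := fun x hx => by
    have h := hEr (show dist x p.re < r₁ by rwa [Real.dist_eq])
    rw [hE1, dist_eq_norm] at h
    exact h.le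
  ---------------------------------------------------------------- the scale `s`
  obtain ⟨s₀, hs₀, hRMs⟩ := hRM ε hε
  set s : ℝ := min (s₀ / 2) (min (r₁ / 2) (ρ / 8)) with hsdef
  have hs : 0 < s := by positivity
  have hss₀ : s < s₀ := by
    have := min_le_left (s₀ / 2) (min (r₁ / 2) (ρ / 8)); linarith
  have hsr₁ : 2 * s ≤ r₁ := by
    have h1 := min_le_right (s₀ / 2) (min (r₁ / 2) (ρ / 8))
    have h2 := min_le_left (r₁ / 2) (ρ / 8); linarith
  have hsρ : 8 * s ≤ ρ := by
    have h1 := min_le_right (s₀ / 2) (min (r₁ / 2) (ρ / 8))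
    have h2 := min_le_right (r₁ / 2) (ρ / 8); linarith
  have hRMε := hRMs s hs hss₀
  set η : ℝ := ε * s with hηdef
  have hη : 0 < η := by positivity
  have hηs : 8 * η ≤ s := by
    rw [hηdef, hεdef]; nlinarith
  ---------------------------------------------------------------- the two bumps
  let βp : ContDiffBump p := ⟨s + η, s + 2 * η, by linarith, by linarith⟩
  let βm : ContDiffBump p := ⟨s - 2 * η, s - η, by linarith, by linarith⟩
  -- common facts about a bump `β` around `p` with `rOut < ρ/2`
  have key : ∀ β : ContDiffBump p, β.rOut ≤ 2 * s →
      0 < ∫ x in Set.Ioo (p.re - ρ / 2) (p.re + ρ / 2), β ((x : ℂ) + (p.im : ℂ) * I) ∧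
      2 * β.rIn ≤ ∫ x in Set.Ioo (p.re - ρ / 2) (p.re + ρ / 2), β ((x : ℂ) + (p.im : ℂ) * I) ∧
      (∫ x in Set.Ioo (p.re - ρ / 2) (p.re + ρ / 2), β ((x : ℂ) + (p.im : ℂ) * I)) ≤ 2 * β.rOut ∧
      ‖(∫ x in Set.Ioo (p.re - ρ / 2) (p.re + ρ / 2), (β ((x : ℂ) + (p.im : ℂ) * I) : ℂ) * E x) -
          ((∫ x in Set.Ioo (p.re - ρ / 2) (p.re + ρ / 2), β ((x : ℂ) + (p.im : ℂ) * I) : ℝ) : ℂ)‖ ≤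
        γ * ∫ x in Set.Ioo (p.re - ρ / 2) (p.re + ρ / 2), β ((x : ℂ) + (p.im : ℂ) * I) ∧
      ((∫ z, β z ∂μ : ℝ) : ℂ) =
        K * ∫ x in Set.Ioo (p.re - ρ / 2) (p.re + ρ / 2), (β ((x : ℂ) + (p.im : ℂ) * I) : ℂ) * E x := by
    intro β hβ
    have hw : Continuous fun x : ℝ => β ((x : ℂ) + (p.im : ℂ) * I) := β.continuous.comp (by fun_prop)
    have hw0 : ∀ x : ℝ, 0 ≤ β ((x : ℂ) + (p.im : ℂ) * I) := fun x => β.nonneg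
    have hwle : ∀ x : ℝ, β ((x : ℂ) + (p.im : ℂ) * I) ≤ 1 := fun x => β.le_one
    have hw1 : ∀ x : ℝ, |x - p.re| ≤ β.rIn → β ((x : ℂ) + (p.im : ℂ) * I) = 1 := fun x hx =>
      β.one_of_mem_closedBall (by rw [mem_closedBall, dist_gatePoint]; exact hx)
    have hw2 : ∀ x : ℝ, β.rOut ≤ |x - p.re| → β ((x : ℂ) + (p.im : ℂ) * I) = 0 := fun x hx =>
      β.zero_of_le_dist (by rw [dist_gatePoint]; exact hx)
    have hrIn : β.rIn ≤ ρ / 2 := by linarith [β.rIn_lt_rOut]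
    have hlow := two_mul_le_integral_bump hw hw0 hw1 β.rIn_pos.le hrIn
    refine ⟨lt_of_lt_of_le (by linarith [β.rIn_pos]) hlow, hlow,
      integral_bump_le_two_mul hw0 hwle hw2 β.rOut_pos.le,
      norm_integral_bump_mul_sub_le hw hw0 hw2 hE fun x hx => hEγ x (by linarith), ?_⟩
    refine hK β β.continuous β.hasCompactSupport ?_
    rw [β.tsupport_eq]
    exact closedBall_subset_ball (by linarith)
  obtain ⟨hVp, hVlp, hVup, hPp, hJp⟩ := key βp (show s + 2 * η ≤ 2 * s by linarith)
  obtain ⟨hVm, hVlm, hVum, hPm, hJm⟩ := key βm (show s - η ≤ 2 * s by linarith)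
  ---------------------------------------------------------------- the lattice sandwich in the limit
  have hlimp := hside βp βp.continuous βp.hasCompactSupport
    (by rw [βp.tsupport_eq]; exact closedBall_subset_ball (show s + 2 * η < ρ / 2 by linarith))
  have hlimm := hside βm βm.continuous βm.hasCompactSupport
    (by rw [βm.tsupport_eq]; exact closedBall_subset_ball (show s - η < ρ / 2 by linarith))
  have hevp := eventually_le_sideSum_of_ratioMixing hAF a hs hη hRMε (w := βp) (fun z => βp.nonneg)
    fun z hz => βp.one_of_mem_closedBall (mem_closedBall.2 (mem_ball.1 hz).le)
  have hevm := eventually_sideSum_le_of_ratioMixing hAF a hs hη hRMε (w := βm) (fun z => βm.le_one)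
    fun z hz => by
      by_contra hzb
      exact hz (βm.zero_of_le_dist (not_lt.1 fun h => hzb (mem_ball.2 h)))
  have hJlp : 2 * s * (1 - ε) ≤ ∫ z, βp z ∂μ := ge_of_tendsto hlimp (hns'.eventually hevp)
  have hJum : ∫ z, βm z ∂μ ≤ 2 * s * (1 + ε) := le_of_tendsto hlimm (hns'.eventually hevm)
  ---------------------------------------------------------------- the data
  refine ⟨∫ z, βp z ∂μ, _, _, ∫ z, βm z ∂μ, _, _, hVp, ?_, hPp, hJp, hVm, ?_, hPm, hJm⟩
  · -- `(1 - γ) Vp ≤ Jp`: `Vp ≤ 2 (s + 2η) = 2s(1 + γ/2)`, `Jp ≥ 2s(1 - γ/4)`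
    have h1 : (1 - γ) * ∫ x in Set.Ioo (p.re - ρ / 2) (p.re + ρ / 2), βp ((x : ℂ) + (p.im : ℂ) * I) ≤
        (1 - γ) * (2 * (s + 2 * η)) := mul_le_mul_of_nonneg_left hVup (by linarith)
    have h2 : (1 - γ) * (2 * (s + 2 * η)) ≤ 2 * s * (1 - ε) := by
      rw [hηdef, hεdef]
      nlinarith [mul_pos hs hγ, mul_pos hs (mul_pos hγ hγ)]
    linarith
  · -- `Jm ≤ (1 + γ) Vm`: `Vm ≥ 2 (s - 2η) = 2s(1 - γ/2)`, `Jm ≤ 2s(1 + γ/4)`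
    have h1 : (1 + γ) * (2 * (s - 2 * η)) ≤
        (1 + γ) * ∫ x in Set.Ioo (p.re - ρ / 2) (p.re + ρ / 2), βm ((x : ℂ) + (p.im : ℂ) * I) :=
      mul_le_mul_of_nonneg_left hVlm (by linarith)
    have h2 : 2 * s * (1 + ε) ≤ (1 + γ) * (2 * (s - 2 * η)) := by
      rw [hηdef, hεdef]
      have h3 : 0 ≤ s * γ * (1 / 2 - γ) := mul_nonneg (mul_pos hs hγ).le (sub_nonneg.2 hγ2)
      nlinarith [h3]
    linarith

/-- **Ratio mixing fixes the constant: `K = 1`** (see the module docstring).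
[cite: LawlerSchrammWerner2004SAW, §3.4 (restriction / boundary scaling heuristics)] -/
theorem const_eq_one_of_ratioMixing {D : DobrushinDomain} {ρ : ℝ} {Λ : ℝ → Finset HexVertex}
    {m : ℝ → ℤ} {b : ℝ → Sym2 HexVertex} (hAF : AdmissibleFamily D ρ Λ m b) {a : ℝ → Sym2 HexVertex}
    (hRM : RatioMixingAt Λ a b) {ns' : ℕ → ℝ} (hns' : Tendsto ns' atTop (𝓝[>] 0)) {μ : Measure ℂ}
    (hside : ∀ w : ℂ → ℝ, Continuous w → HasCompactSupport w → tsupport w ⊆ ball (D.pt 1) (ρ / 2) →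
      Tendsto (fun n => ns' n * ∑ᶠ e ∈ hexDomainBoundary (Λ (ns' n)),
        w ((ns' n : ℂ) * hexMidpoint e) *
          (‖hexParafermionicObservable (Λ (ns' n)) (a (ns' n)) hexCriticalFugacity 0 e‖ /
            ‖hexParafermionicObservable (Λ (ns' n)) (a (ns' n)) hexCriticalFugacity 0 (b (ns' n))‖))
        atTop (𝓝 (∫ z, w z ∂μ)))
    {E : ℝ → ℂ} (hE : ContinuousOn E (Icc ((D.pt 1).re - ρ / 2) ((D.pt 1).re + ρ / 2)))
    (hE1 : E (D.pt 1).re = 1) {K : ℂ}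
    (hK : ∀ w : ℂ → ℝ, Continuous w → HasCompactSupport w → tsupport w ⊆ ball (D.pt 1) (ρ / 2) →
      ((∫ z, w z ∂μ : ℝ) : ℂ) = K * ∫ x in Set.Ioo ((D.pt 1).re - ρ / 2) ((D.pt 1).re + ρ / 2),
        (w ((x : ℂ) + ((D.pt 1).im : ℂ) * I) : ℂ) * E x) :
    K = 1 := by
  -- sandwich data at every scale `γ > 0` (only `γ ≤ 1/2` matters)
  have hdata : ∀ γ : ℝ, 0 < γ →
      ∃ (Jp Vp : ℝ) (Pp : ℂ) (Jm Vm : ℝ) (Pm : ℂ), 0 < Vp ∧ (1 - γ) * Vp ≤ Jp ∧ ‖Pp - Vp‖ ≤ γ * Vp ∧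
        (Jp : ℂ) = K * Pp ∧ 0 < Vm ∧ Jm ≤ (1 + γ) * Vm ∧ ‖Pm - Vm‖ ≤ γ * Vm ∧ (Jm : ℂ) = K * Pm := by
    intro γ hγ
    obtain ⟨Jp, Vp, Pp, Jm, Vm, Pm, hVp, hJp, hPp, hKp, hVm, hJm, hPm, hKm⟩ :=
      exists_sandwich_data hAF hRM hns' hside hE hE1 hK (lt_min hγ (by norm_num : (0 : ℝ) < 1 / 2))
        (min_le_right _ _)
    have hγ' : min γ (1 / 2) ≤ γ := min_le_left _ _
    refine ⟨Jp, Vp, Pp, Jm, Vm, Pm, hVp, ?_, ?_, hKp, hVm, ?_, ?_, hKm⟩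
    · nlinarith
    · exact hPp.trans (mul_le_mul_of_nonneg_right hγ' hVp.le)
    · nlinarith
    · exact hPm.trans (mul_le_mul_of_nonneg_right hγ' hVm.le)
  refine eq_one_of_sandwich (fun γ hγ => ?_) (fun γ hγ => ?_)
  · obtain ⟨Jp, Vp, Pp, -, -, -, hVp, hJp, hPp, hKp, -⟩ := hdata γ hγ
    exact ⟨Jp, Vp, Pp, hVp, hJp, hPp, hKp⟩
  · obtain ⟨-, -, -, Jm, Vm, Pm, -, -, -, -, hVm, hJm, hPm, hKm⟩ := hdata γ hγ
    exact ⟨Jm, Vm, Pm, hVm, hJm, hPm, hKm⟩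

/-! ### Registered form (sub-goal of `gateProfile_of_identification`) -/

/-- **Registered sub-goal `gateProfile_constEqOne`** (crux item stmt-CriticalPhenomena-14004, line
`polygon-parity-squeeze`, stub `gateProfile_of_identification`, piece F of the (A) assembly): registry
form (one `∀`-term) of `const_eq_one_of_ratioMixing` — ratio mixing fixes the constant.
[cite: LawlerSchrammWerner2004SAW, §3.4 (restriction / boundary scaling heuristics)] -/
theorem gateProfile_constEqOne : ∀ (D : DobrushinDomain) (ρ : ℝ) (Λ : ℝ → Finset HexVertex) (m : ℝ → ℤ) (b : ℝ → Sym2 HexVertex), AdmissibleFamily D ρ Λ m b → ∀ (a : ℝ → Sym2 HexVertex), RatioMixingAt Λ a b → ∀ (ns' : ℕ → ℝ), Filter.Tendsto ns' Filter.atTop (𝓝[>] 0) → ∀ (μ : MeasureTheory.Measure ℂ), (∀ w : ℂ → ℝ, Continuous w → HasCompactSupport w → tsupport w ⊆ Metric.ball (D.pt 1) (ρ / 2) → Filter.Tendsto (fun n => ns' n * ∑ᶠ e ∈ hexDomainBoundary (Λ (ns' n)), w ((ns' n : ℂ) * hexMidpoint e) * (‖hexParafermionicObservable (Λ (ns' n))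 (a (ns' n)) hexCriticalFugacity 0 e‖ / ‖hexParafermionicObservable (Λ (ns' n)) (a (ns' n)) hexCriticalFugacity 0 (b (ns' n))‖)) Filter.atTop (𝓝 (∫ z, w z ∂μ))) → ∀ (E : ℝ → ℂ), ContinuousOn E (Set.Icc ((D.pt 1).re - ρ / 2) ((D.pt 1).re + ρ / 2)) → E (D.pt 1).re = 1 → ∀ (K : ℂ), (∀ w : ℂ → ℝ, Continuous w → HasCompactSupport w → tsupport w ⊆ Metric.ball (D.pt 1) (ρ / 2) → ((∫ z, w z ∂μ : ℝ) : ℂ) = K * ∫ x in Set.Ioo ((D.pt 1).re - ρ / 2) ((D.pt 1).re + ρ / 2), (w ((x : ℂ) + ((D.pt 1).im : ℂ) * Complex.I) : ℂ) * E x) → K = 1 :=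
  fun _ _ _ _ _ hAF _ hRM _ hns' _ hside _ hE hE1 _ hK =>
    const_eq_one_of_ratioMixing hAF hRM hns' hside hE hE1 hK

end Summit.CriticalPhenomena.SAWScalingLimit.Theorems.PolygonParitySqueeze.GateProfile

end
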